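import Mathlib

/-!
# Tier7/Line3/WeightProjectorStrong — the isotypic projector under STRONG continuity only (seat t7-L1-p4)

crit-2's objection at STATUS l. 15231 on `Tier7/Line3/WeightProjector` (p676427): its theorems carry
`hτ : Continuous τ`, continuity of `t ↦ τ t` in the OPERATOR-NORM topology, which FAILS for the restriction of an
infinite-dimensional unitary representation (the discrete series `D_k` at `ι₂, ι₃`) to the torus `T_A(F_v)` — infinitely
many weights, `‖τ t − 1‖ = 2` off a null set. The integrand `t ↦ conj (χ t) • τ t v` only needs POINTWISE (strong)
continuity, which every unitary representation of a compact group on a Hilbert space has. THIS FILE is the repair (b)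
of that objection: the same statements and proofs with

  `hτ : ∀ v, Continuous fun t => τ t v`

in place of `Continuous τ` — `V` of ANY dimension, so the rows now cover every archimedean place. `strong_of_continuous`
records that norm continuity implies the hypothesis (and `continuous_clm_apply` gives the converse when `V` is
finite-dimensional, the situation of `SchurProjector`). Statements: `weightProj μ τ χ v := ∫ conj (χ t) • τ t v dμ`,
`weightProj_of_isWeightVector`, `isWeightVector_weightProj`, `weightProj_weightProj`, `apply_weightProj_of_equivariant`
(a `χ`-equivariant functional factors through the projector), `inner_weightProj`, `weightProj_eq_inner_smul` (multiplicity
one: `weightProj v = ⟪u, v⟫ • u`) and `apply_eq_inner_mul_of_equivariant` (`P v = ⟪u, v⟫ * P u` — the A-side loses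
nothing), exactly as in `WeightProjector`. Nothing about an adelic group, a period or (N); no device. No sorry;
axioms ⊆ {propext, Classical.choice, Quot.sound}.
-/

namespace Summit.Ventures.HodgeRepro2.Tier7.Line3.WeightProjectorStrong

open MeasureTheory
open scoped InnerProductSpace

variable {T : Type*} [Group T]
variable {V : Type*} [NormedAddCommGroup V] [InnerProductSpace ℂ V]

/-- `τ (a * b) v = τ a (τ b v)`. -/
theorem apply_mul_apply (τ : T →* (V →L[ℂ] V)) (a b : T) (v : V) : τ (a * b) v = τ a (τ b v) := by
  rw [map_mul, ContinuousLinearMap.mul_def, ContinuousLinearMap.comp_apply]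

/-- norm continuity of `τ` gives the strong continuity hypothesis of this file. -/
theorem strong_of_continuous [TopologicalSpace T] (τ : T →* (V →L[ℂ] V)) (hτ : Continuous τ) (v : V) :
    Continuous fun t => τ t v :=
  hτ.clm_apply continuous_const

/-- a unitary character: `‖χ t‖ = 1`, i.e. `conj (χ t) * χ t = 1`. -/
def IsUnitaryChar (χ : T →* ℂ) : Prop := ∀ t, ‖χ t‖ = 1

/-- `conj (χ t) * χ t = 1` for a unitary character. -/
theorem IsUnitaryChar.conj_mul {χ : T →* ℂ} (hχ : IsUnitaryChar χ) (t : T) :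
    (starRingEnd ℂ) (χ t) * χ t = 1 := by
  rw [Complex.conj_mul', hχ t]
  norm_num

/-- `conj (χ t⁻¹) = χ t` for a unitary character. -/
theorem IsUnitaryChar.conj_inv {χ : T →* ℂ} (hχ : IsUnitaryChar χ) (t : T) :
    (starRingEnd ℂ) (χ t⁻¹) = χ t := by
  have h1 : χ t⁻¹ * χ t = 1 := by rw [← map_mul, inv_mul_cancel, map_one]
  have h1' : χ t⁻¹ = (χ t)⁻¹ := eq_inv_of_mul_eq_one_left h1
  have h2' : (starRingEnd ℂ) (χ t) = (χ t)⁻¹ := eq_inv_of_mul_eq_one_left (hχ.conj_mul t)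
  rw [h1', map_inv₀, h2', inv_inv]

/-- a `χ`-weight vector: `τ t v = χ t • v` for every `t`. -/
def IsWeightVector (τ : T →* (V →L[ℂ] V)) (χ : T →* ℂ) (v : V) : Prop := ∀ t, τ t v = χ t • v

/-- the isotypic projector of the character `χ`: `v ↦ ∫ conj (χ t) • τ t v dμ`. -/
noncomputable def weightProj [MeasurableSpace T] (μ : Measure T) (τ : T →* (V →L[ℂ] V)) (χ : T →* ℂ) (v : V) :
    V := ∫ t, (starRingEnd ℂ) (χ t) • τ t v ∂μ

section Integrability

/-- the integrand of the projector is continuous. -/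
theorem continuous_integrand [TopologicalSpace T] (τ : T →* (V →L[ℂ] V)) (χ : T →* ℂ) (hτ : ∀ v, Continuous fun t => τ t v)
    (hχ : Continuous χ) (v : V) : Continuous fun t => (starRingEnd ℂ) (χ t) • τ t v :=
  (Complex.continuous_conj.comp hχ).smul (hτ v)

/-- the integrand of the projector is integrable. -/
theorem integrable_integrand [TopologicalSpace T] [CompactSpace T] [MeasurableSpace T] [BorelSpace T]
    (μ : Measure T) [IsFiniteMeasure μ] (τ : T →* (V →L[ℂ] V)) (χ : T →* ℂ)
    (hτ : ∀ v, Continuous fun t => τ t v) (hχ : Continuous χ) (v : V) :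
    Integrable (fun t => (starRingEnd ℂ) (χ t) • τ t v) μ :=
  (continuous_integrand τ χ hτ hχ v).integrable_of_hasCompactSupport (HasCompactSupport.of_compactSpace _)

/-- **a weight vector is fixed by its projector**: `weightProj v = v` for a `χ`-weight vector. -/
theorem weightProj_of_isWeightVector [MeasurableSpace T] (μ : Measure T) [IsProbabilityMeasure μ]
    [CompleteSpace V] (τ : T →* (V →L[ℂ] V))
    (χ : T →* ℂ) (hχu : IsUnitaryChar χ) {v : V} (hv : IsWeightVector τ χ v) : weightProj μ τ χ v = v := by
  unfold weightProj
  have e : (fun t => (starRingEnd ℂ) (χ t) • τ t v) = fun _ => v := by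
    funext t
    rw [hv t, smul_smul, hχu.conj_mul, one_smul]
  rw [e, integral_const]
  simp

/-- **the projector lands in the weight space**: `weightProj v` is a `χ`-weight vector (left invariance). -/
theorem isWeightVector_weightProj [TopologicalSpace T] [IsTopologicalGroup T] [CompactSpace T]
    [MeasurableSpace T] [BorelSpace T] (μ : Measure T) [IsFiniteMeasure μ] [μ.IsMulLeftInvariant]
    [CompleteSpace V] (τ : T →* (V →L[ℂ] V)) (χ : T →* ℂ) (hτ : ∀ v, Continuous fun t => τ t v) (hχ : Continuous χ)
    (hχu : IsUnitaryChar χ) (v : V) : IsWeightVector τ χ (weightProj μ τ χ v) := by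
  intro s
  unfold weightProj
  rw [← (τ s).integral_comp_comm (integrable_integrand μ τ χ hτ hχ v), ← integral_smul]
  -- substitute `t ↦ s⁻¹ * t`
  have e : (fun t => τ s ((starRingEnd ℂ) (χ t) • τ t v)) =
      fun t => χ s • ((starRingEnd ℂ) (χ (s * t)) • τ (s * t) v) := by
    funext t
    rw [map_smul, ← apply_mul_apply τ s t v, smul_smul, map_mul χ s t, map_mul (starRingEnd ℂ) (χ s) (χ t)]
    congr 1
    rw [← mul_assoc, mul_comm (χ s), hχu.conj_mul, one_mul]
  rw [e]
  exact integral_mul_left_eq_self (fun t' => χ s • ((starRingEnd ℂ) (χ t') • τ t' v)) s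

/-- **idempotence**: `weightProj (weightProj v) = weightProj v`. -/
theorem weightProj_weightProj [TopologicalSpace T] [IsTopologicalGroup T] [CompactSpace T]
    [MeasurableSpace T] [BorelSpace T] (μ : Measure T) [IsProbabilityMeasure μ] [μ.IsMulLeftInvariant]
    [CompleteSpace V] (τ : T →* (V →L[ℂ] V)) (χ : T →* ℂ) (hτ : ∀ v, Continuous fun t => τ t v) (hχ : Continuous χ)
    (hχu : IsUnitaryChar χ) (v : V) : weightProj μ τ χ (weightProj μ τ χ v) = weightProj μ τ χ v :=
  weightProj_of_isWeightVector μ τ χ hχu (isWeightVector_weightProj μ τ χ hτ hχ hχu v)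

/-- **a `χ`-equivariant functional factors through the projector**: `P (weightProj v) = P v`. -/
theorem apply_weightProj_of_equivariant [TopologicalSpace T] [CompactSpace T] [MeasurableSpace T]
    [BorelSpace T] (μ : Measure T) [IsProbabilityMeasure μ] [CompleteSpace V] (τ : T →* (V →L[ℂ] V))
    (χ : T →* ℂ) (hτ : ∀ v, Continuous fun t => τ t v) (hχ : Continuous χ) (hχu : IsUnitaryChar χ) (P : V →L[ℂ] ℂ)
    (hP : ∀ t v, P (τ t v) = χ t * P v) (v : V) : P (weightProj μ τ χ v) = P v := by
  unfold weightProj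
  rw [← P.integral_comp_comm (integrable_integrand μ τ χ hτ hχ v)]
  have e : (fun t => P ((starRingEnd ℂ) (χ t) • τ t v)) = fun _ => P v := by
    funext t
    rw [map_smul, hP, smul_eq_mul, ← mul_assoc, hχu.conj_mul, one_mul]
  rw [e, integral_const]
  simp

/-- a unitary representation: every `τ t` preserves the inner product. -/
def IsUnitaryRep (τ : T →* (V →L[ℂ] V)) : Prop := ∀ t x y, ⟪τ t x, τ t y⟫_ℂ = ⟪x, y⟫_ℂ

/-- `⟪u, weightProj v⟫ = ⟪u, v⟫` for a `χ`-weight vector `u` (unitary `τ`, unitary `χ`). -/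
theorem inner_weightProj [TopologicalSpace T] [CompactSpace T] [MeasurableSpace T] [BorelSpace T]
    (μ : Measure T) [IsProbabilityMeasure μ] [CompleteSpace V] (τ : T →* (V →L[ℂ] V))
    (χ : T →* ℂ) (hτ : ∀ v, Continuous fun t => τ t v) (hτu : IsUnitaryRep τ) (hχ : Continuous χ) (hχu : IsUnitaryChar χ)
    {u : V} (hu : IsWeightVector τ χ u) (v : V) : ⟪u, weightProj μ τ χ v⟫_ℂ = ⟪u, v⟫_ℂ := by
  unfold weightProj
  rw [← integral_inner (integrable_integrand μ τ χ hτ hχ v)]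
  have e : (fun t => ⟪u, (starRingEnd ℂ) (χ t) • τ t v⟫_ℂ) = fun _ => ⟪u, v⟫_ℂ := by
    funext t
    have h1 : ⟪u, τ t v⟫_ℂ = ⟪τ t⁻¹ u, v⟫_ℂ := by
      have h2 : τ t⁻¹ (τ t v) = v := by
        rw [← apply_mul_apply, inv_mul_cancel, map_one, one_apply_eq_self]
      calc ⟪u, τ t v⟫_ℂ = ⟪τ t⁻¹ u, τ t⁻¹ (τ t v)⟫_ℂ := (hτu t⁻¹ u (τ t v)).symm
        _ = ⟪τ t⁻¹ u, v⟫_ℂ := by rw [h2]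
    rw [inner_smul_right, h1, hu t⁻¹, inner_smul_left, hχu.conj_inv, ← mul_assoc, hχu.conj_mul, one_mul]
  rw [e, integral_const]
  simp

/-- **multiplicity one**: if the `χ`-weight space is the line `ℂ u` (`‖u‖ = 1`), the projector is the rank-one
projector `v ↦ ⟪u, v⟫ • u`. -/
theorem weightProj_eq_inner_smul [TopologicalSpace T] [IsTopologicalGroup T] [CompactSpace T]
    [MeasurableSpace T] [BorelSpace T] (μ : Measure T) [IsProbabilityMeasure μ] [μ.IsMulLeftInvariant]
    [CompleteSpace V] (τ : T →* (V →L[ℂ] V)) (χ : T →* ℂ) (hτ : ∀ v, Continuous fun t => τ t v) (hτu : IsUnitaryRep τ)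
    (hχ : Continuous χ) (hχu : IsUnitaryChar χ) {u : V} (hu : IsWeightVector τ χ u) (hu1 : ‖u‖ = 1)
    (hmult : ∀ w, IsWeightVector τ χ w → ∃ c : ℂ, w = c • u) (v : V) :
    weightProj μ τ χ v = ⟪u, v⟫_ℂ • u := by
  obtain ⟨c, hc⟩ := hmult _ (isWeightVector_weightProj μ τ χ hτ hχ hχu v)
  have h := inner_weightProj μ τ χ hτ hτu hχ hχu hu v
  rw [hc, inner_smul_right, inner_self_eq_norm_sq_to_K, hu1] at h
  have h' : c = ⟪u, v⟫_ℂ := by simpa using h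
  rw [hc, h']

/-- **the `A`-side loses nothing**: with multiplicity one, every `χ`-equivariant functional factors through the
rank-one projector onto `u`: `P v = ⟪u, v⟫ * P u`. -/
theorem apply_eq_inner_mul_of_equivariant [TopologicalSpace T] [IsTopologicalGroup T] [CompactSpace T]
    [MeasurableSpace T] [BorelSpace T] (μ : Measure T) [IsProbabilityMeasure μ] [μ.IsMulLeftInvariant]
    [CompleteSpace V] (τ : T →* (V →L[ℂ] V)) (χ : T →* ℂ) (hτ : ∀ v, Continuous fun t => τ t v) (hτu : IsUnitaryRep τ)
    (hχ : Continuous χ) (hχu : IsUnitaryChar χ) {u : V} (hu : IsWeightVector τ χ u) (hu1 : ‖u‖ = 1)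
    (hmult : ∀ w, IsWeightVector τ χ w → ∃ c : ℂ, w = c • u) (P : V →L[ℂ] ℂ)
    (hP : ∀ t v, P (τ t v) = χ t * P v) (v : V) : P v = ⟪u, v⟫_ℂ * P u := by
  rw [← apply_weightProj_of_equivariant μ τ χ hτ hχ hχu P hP v,
    weightProj_eq_inner_smul μ τ χ hτ hτu hχ hχu hu hu1 hmult v, map_smul, smul_eq_mul]

end Integrability

end Summit.Ventures.HodgeRepro2.Tier7.Line3.WeightProjectorStrong
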